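import Mathlib
import HarnessLib
import Summits.CriticalPhenomena.PercolationContinuityZ3.Theses.PercTreeValue
import Literature.Probability.Percolation.BondPercolationSymmetry
import Literature.Probability.Percolation.SeedLemma
import Literature.Probability.LatticeModels.LatticeGraph
import Literature.Probability.LatticeModels.ThermodynamicLimit

/-!
# `stub_shiftBoxCrossing` of line `Sketch` (crux `TetrahedronDisjointCoexistence`,
# stmt-CriticalPhenomena-7798): translation of the annulus-crossing event of X_B

Registered stub `stub_shiftBoxCrossing` (S2) of the lead's skeleton
`Cruxes/TetrahedronDisjointCoexistence/Lines/Sketch.lean`, landed DEF-FREE over tree declarations.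

For `P = bondPercolation (zdGraph 3) p` (every `p`), every `v ∈ ℤ³` and every `n`, the event
"some vertex of `v + B(n)` is joined inside `v + B(2n)` to a vertex of `v + B(2n)` adjacent to the
complement of `v + B(2n)`" has the same probability as the centred event
"`∃ x ∈ B(n), ∃ y ∈ ∂B(2n), x ↔ y in B(2n)`" of `PercAnnulusCrossing.CritAnnulusNonCrossing`.

Proof. The translated event is the preimage of the centred one under the shift of configurations
`ω ↦ ω - v` (`BondConfig.relabel (sym2Equiv (Site.shift (-v)))`): the open graph of `ω - v` is
isomorphic to that of `ω` along `u ↦ u - v` (`openGraph_relabel_adj_iff`), so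
`ω - v ∈ {x' ↔ y' in B(2n)} ↔ ω ∈ {x' + v ↔ y' + v in v + B(2n)}`
(`GM.relabel_mem_openConnIn_iff`, `shiftBoxCrossing_relabel_shift_mem_openConnIn_iff`), and `y' ∈ ∂B(2n)` iff `y' + v ∈ v + B(2n)` has a
lattice neighbour outside `v + B(2n)` (`zdGraph_adj_shift_iff`). Translation invariance of bond
percolation (`bondPercolation_real_preimage_shift`) then gives the equality of probabilities.
-/

noncomputable section

namespace Summit.CriticalPhenomena.PercolationContinuityZ3.Theorems.TetrahedronDisjointCoexistence

open MeasureTheory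
open Literature.Probability.Percolation Literature.Probability.LatticeModels

/-- Transfer of restricted open connections to the translated frame:
`ω - v ∈ {x ↔ y in B(m)} ↔ ω ∈ {x + v ↔ y + v in v + B(m)}`, with `v + B(m)` written as
`{u | u - v ∈ B(m)}` (the relabelling transport `GM.relabel_mem_openConnIn_iff` of `SeedLemma.lean`
along the shift `u ↦ u - v`; cf. `DKT20.relabel_shift_mem_openConnIn_iff`). -/
theorem shiftBoxCrossing_relabel_shift_mem_openConnIn_iff (v : Site 3) (m : ℕ) (x y : Site 3)
    (ω : BondConfig (Site 3)) :
    BondConfig.relabel (sym2Equiv (Site.shift (-v))) ω ∈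
        openConnIn (↑(box 3 m) : Set (Site 3)) x y ↔
      ω ∈ openConnIn {u : Site 3 | u - v ∈ box 3 m} (x + v) (y + v) := by
  have h := GM.relabel_mem_openConnIn_iff (Site.shift (-v)) (↑(box 3 m) : Set (Site 3))
    (x + v) (y + v) ω
  simp only [Site.shift_apply, add_neg_cancel_right] at h
  rw [h]
  have hS : Site.shift (-v) ⁻¹' (↑(box 3 m) : Set (Site 3)) = {u : Site 3 | u - v ∈ box 3 m} := by
    ext u
    simp only [Set.mem_preimage, Site.shift_apply, Finset.mem_coe, Set.mem_setOf_eq, ← sub_eq_add_neg]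
  rw [hS]

/-- The translated annulus-crossing event is the preimage of the centred one under the shift of
configurations `ω ↦ ω - v`. -/
theorem shiftBoxCrossing_event_eq (v : Site 3) (n : ℕ) :
    {ω : BondConfig (Site 3) | ∃ x : Site 3, x - v ∈ box 3 n ∧ ∃ y : Site 3,
        y - v ∈ box 3 (2 * n) ∧ (∃ z : Site 3, z - v ∉ box 3 (2 * n) ∧ (zdGraph 3).Adj y z) ∧
          ω ∈ openConnIn {u : Site 3 | u - v ∈ box 3 (2 * n)} x y} =
      BondConfig.relabel (sym2Equiv (Site.shift (-v))) ⁻¹'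
        {ω | ∃ x ∈ box 3 n, ∃ y ∈ innerBoundary (zdGraph 3) (box 3 (2 * n)),
          ω ∈ openConnIn ↑(box 3 (2 * n)) x y} := by
  ext ω
  simp only [Set.mem_setOf_eq, Set.mem_preimage]
  constructor
  · rintro ⟨x, hx, y, hy, ⟨z, hz, hyz⟩, hω⟩
    refine ⟨x - v, hx, y - v, ?_, ?_⟩
    · rw [mem_innerBoundary_iff]
      refine ⟨hy, z - v, hz, ?_⟩
      have h := (zdGraph_adj_shift_iff (-v) y z).2 hyz
      simp only [Site.shift_apply, ← sub_eq_add_neg] at h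
      exact h
    · rw [shiftBoxCrossing_relabel_shift_mem_openConnIn_iff, sub_add_cancel, sub_add_cancel]
      exact hω
  · rintro ⟨x', hx', y', hy', hω⟩
    rw [mem_innerBoundary_iff] at hy'
    obtain ⟨hy'mem, z', hz', hadj⟩ := hy'
    rw [shiftBoxCrossing_relabel_shift_mem_openConnIn_iff] at hω
    refine ⟨x' + v, ?_, y' + v, ?_, ⟨z' + v, ?_, ?_⟩, hω⟩
    · rwa [add_sub_cancel_right]
    · rwa [add_sub_cancel_right]
    · rwa [add_sub_cancel_right]
    · have h := (zdGraph_adj_shift_iff v y' z').2 hadj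
      simp only [Site.shift_apply] at h
      exact h

/-- **S2 — translation of the X_B event.** Translation invariance of `P_p` on `ℤ³` for the
annulus-crossing event of X_B: the event "some vertex of `v + B(n)` is joined inside `v + B(2n)` to
a vertex of `v + B(2n)` adjacent to its complement" has the probability of the centred event of
`PercAnnulusCrossing.CritAnnulusNonCrossing` (the translated event is the preimage of the centred
one under `ω ↦ ω - v`, `shiftBoxCrossing_event_eq`, and `P_p` is translation invariant,
`bondPercolation_real_preimage_shift`). -/
theorem stub_shiftBoxCrossing (p : unitInterval) (v : Site 3) (n : ℕ) :
    (bondPercolation (zdGraph 3) p).real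
        {ω | ∃ x : Site 3, x - v ∈ box 3 n ∧ ∃ y : Site 3, y - v ∈ box 3 (2 * n) ∧
          (∃ z : Site 3, z - v ∉ box 3 (2 * n) ∧ (zdGraph 3).Adj y z) ∧
          ω ∈ openConnIn {u : Site 3 | u - v ∈ box 3 (2 * n)} x y} =
      (bondPercolation (zdGraph 3) p).real
        {ω | ∃ x ∈ box 3 n, ∃ y ∈ innerBoundary (zdGraph 3) (box 3 (2 * n)),
          ω ∈ openConnIn ↑(box 3 (2 * n)) x y} := by
  rw [shiftBoxCrossing_event_eq v n]
  exact bondPercolation_real_preimage_shift (-v) p _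

end Summit.CriticalPhenomena.PercolationContinuityZ3.Theorems.TetrahedronDisjointCoexistence

end
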